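import Summits.AtomisticToContinuum.Crystallization.Theorems.OverbindingBudgetAffineFarFieldCollarSites
import Summits.AtomisticToContinuum.Crystallization.Theorems.OverbindingBudgetAffineFarFieldCollarBand
import Summits.AtomisticToContinuum.Crystallization.Theorems.OverbindingBudgetAffineFarFieldCollarAssembly

/-!
# Overbinding budget, affine far field — «CollarWindow»: the interface row for THE reference tessellation, window glossary

Support file for `Summit.AtomisticToContinuum.Crystallization.Theses.OverbindingBudget.RobustDefectLimitWindows`
(sub-problem (2c), leaf SW♭(30), part 27V «Voronoi-cell quadrature of the far field», interface row, design (R*)).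
«CollarAssembly» proves the interface row over an abstract indexed pair of tessellations; this file INSTANTIATES it
for the route's objects and names the WINDOW FACTS the defect-limit window must carry (the glossary of WIRING-27Vc §6):

* the REFERENCE tessellation = Voronoi cells `refCell u` of the placed close-packed sites `placedSite s ν q R u`,
  `u : ℤ × ℤ × ℤ` («CollarSites»: cover, circumradius `r₀ = ν/√2`, local finiteness, integer distance form);
* the ACTUAL configuration = charted atoms `ych u`, `u ∈ Ach` (a chart: which reference sites carry an atom) and
  uncharted atoms `yunc e`, `e : μ` (defect core); `windowAtomSet = ych '' Ach ∪ range yunc`; actual cells = Voronoi cells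
  of `windowAtomSet`; everything indexed by `ι = (ℤ × ℤ × ℤ) ⊕ μ` (`refCellI`, `actCellI`, `siteI`, `atomIdx`, `chartedI`, `collarCoreIdx`);
* the bookkeeping CORE = sites within `r_c` of a centre `q₀` (plus all uncharted atoms); `collarRefCore`, `collarActCore`.

WINDOW FACTS (hypotheses of ★ `interfaceRow_window`, all in ACTUAL-POSITION form, nothing assumed inside the defect core):
(W-band) every site with `r_c − m < dist (site) q₀ < r_c + M` is charted, displaced by `≤ û`, and its actual cell is
`w u`-near its reference cell (the F1 rows, via `CollarBand.nearness_of_rows`), with `2r₀ < m`, `r₀ < M`;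
(W-core) every charted core atom off the band and every uncharted atom lies within `r_c − m'` of `q₀`, `m' > 2r₀ + û`;
(W-far) every charted outer atom off the band lies at `≥ r_c + M'` from `q₀`, `M' > 3r₀ + û`;
ATLAS FACTS (27V-I, integer arithmetic): the piece list `I ⊇` (core, non-core) pairs with `barlowSiteForm ≤ 24`, each of
form `12` (bond) or `24` (√2-contact); widths `W k ≥ 0` dominating `w u` on the star
`dist (site u) (midpoint k) ≤ r₀ + 2 w u + pieceRadius k`; tube volume books `V k`; kernel bounds `c k ≥ 0` on the tubes.
CONCLUSION: `|∫_{collarActCore} g − ∫_{collarRefCore} g| ≤ Σ_{k ∈ I} c k · V k`.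

[this file; Conway–Sloane, Sphere Packings ch. 2, 21]
-/

namespace Summit.AtomisticToContinuum.Crystallization.Theorems.OverbindingBudgetAffineFarFieldCollarWindow

noncomputable section

open Set MeasureTheory Metric
open Literature.MathematicalPhysics.StatisticalMechanics (IsHaggSeq)
open Literature.Barriers.AtomisticToContinuum (voronoiCell isClosed_voronoiCell)
open Summit.AtomisticToContinuum.Crystallization.Theorems.OverbindingBudgetAffineFarFieldCollar
open Summit.AtomisticToContinuum.Crystallization.Theorems.OverbindingBudgetAffineFarFieldCollarLocal
open Summit.AtomisticToContinuum.Crystallization.Theorems.OverbindingBudgetAffineFarFieldCollarBand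
open Summit.AtomisticToContinuum.Crystallization.Theorems.OverbindingBudgetAffineFarFieldCollarAssembly
open Summit.AtomisticToContinuum.Crystallization.Theorems.OverbindingBudgetAffineFarFieldCollarSites

local notation "E3" => EuclideanSpace ℝ (Fin 3)
local notation "Idx" => ℤ × ℤ × ℤ

/-! ## §0 A far-outer vacuity in actual-position form -/
/-- support (W-far form of `CollarBand.far_outer_disjoint`): with reference cells of circumradius `r₀`, core sites
within `r_c` of `q₀`, actual cells on which `y i` is a nearest atom, and no hole of radius `D₀` in the charted annulus
(`r₀ ≤ a`), an atom with `r_c + M' ≤ dist (y i) q₀`, `M' > 2r₀ + D₀`, has its actual cell disjoint from the reference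
core union — no chart needed for `i`. [this file] -/
theorem far_outer_disjoint_of_pos {ι : Type*} {K₁ K₂ : ι → Set E3} {C At : Set ι} {qref y : ι → E3} {q₀ : E3}
    {r_c r₀ a D₀ M' : ℝ} {i : ι} (hrc : 0 < r_c) (har : r₀ ≤ a) (hK₁ : ∀ j, K₁ j ⊆ closedBall (qref j) r₀)
    (hin : ∀ j ∈ C, dist (qref j) q₀ ≤ r_c) (hK₂ : ∀ x ∈ K₂ i, ∀ j ∈ At, dist x (y i) ≤ dist x (y j))
    (hhole : ∀ x, r_c - a ≤ dist x q₀ → dist x q₀ ≤ r_c → ∃ j ∈ At, dist x (y j) ≤ D₀)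
    (hfar : r_c + M' ≤ dist (y i) q₀) (hM : 2 * r₀ + D₀ < M') : K₂ i ∩ ⋃ j ∈ C, K₁ j = ∅ := by
  ext x
  simp only [mem_inter_iff, mem_empty_iff_false, iff_false, not_and]
  intro hx hxU
  obtain ⟨j, hjC, hxj⟩ := mem_iUnion₂.1 hxU
  have hxq : dist x (qref j) ≤ r₀ := mem_closedBall.1 (hK₁ j hxj)
  have hr₀ : 0 ≤ r₀ := dist_nonneg.trans hxq
  have htri : dist x q₀ ≤ dist x (qref j) + dist (qref j) q₀ := dist_triangle x (qref j) q₀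
  have hxin : dist x q₀ ≤ r_c + r₀ := by linarith [hin j hjC]
  have hsphere : ∀ z, dist z q₀ = r_c → ∃ j ∈ At, dist z (y j) ≤ D₀ :=
    fun z hz => hhole z (by linarith [hr₀.trans har]) hz.le
  have htri2 : dist (y i) q₀ ≤ dist (y i) x + dist x q₀ := dist_triangle (y i) x q₀
  rcases le_or_gt (dist x q₀) r_c with hle | hlt
  · obtain ⟨j', hj', hjd⟩ := exists_atom_near_of_noHole_out hrc hsphere hle
    have h := hK₂ x hx j' hj'
    rw [dist_comm x (y i)] at h
    linarith
  · obtain ⟨j', hj', hjd⟩ := exists_atom_near_of_noHole hrc hsphere hlt.le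
    have h := hK₂ x hx j' hj'
    rw [dist_comm x (y i)] at h
    linarith

/-! ## §1 The objects -/
section Objects

variable {μ : Type*} (s : ℤ → ℤ) (ν : ℝ) (q : E3) (R : E3 ≃ₗᵢ[ℝ] E3) (Ach : Set Idx) (ych : Idx → E3) (yunc : μ → E3)
  (q₀ : E3) (r_c : ℝ)

/-- The reference cell of the site `u`: its Voronoi cell in the placed stacking. -/
def refCell (u : Idx) : Set E3 := voronoiCell (range (placedSite s ν q R)) (placedSite s ν q R u)

/-- The actual atom set: charted atoms `ych u`, `u ∈ Ach`, and uncharted atoms `yunc e`. -/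
def windowAtomSet : Set E3 := ych '' Ach ∪ range yunc

/-- The bookkeeping core: sites within `r_c` of `q₀`. -/
def collarCoreSites : Set Idx := {u | dist (placedSite s ν q R u) q₀ ≤ r_c}

/-- The reference core union `Uc₁`. -/
def collarRefCore : Set E3 := ⋃ u ∈ collarCoreSites s ν q R q₀ r_c, refCell s ν q R u

/-- The actual core union `Uc₂`: the actual cells of the charted core sites and of all uncharted atoms. -/
def collarActCore : Set E3 :=
  (⋃ u ∈ collarCoreSites s ν q R q₀ r_c ∩ Ach, voronoiCell (windowAtomSet Ach ych yunc) (ych u)) ∪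
    ⋃ e, voronoiCell (windowAtomSet Ach ych yunc) (yunc e)

/-- Reference cells indexed by `ι = Idx ⊕ μ` (uncharted atoms carry the empty reference cell). -/
def refCellI : Idx ⊕ μ → Set E3 := Sum.elim (refCell s ν q R) fun _ => ∅

/-- Actual cells indexed by `ι` (a vacant site carries the empty actual cell). -/
def actCellI : Idx ⊕ μ → Set E3 :=
  Sum.elim (fun u => {x | u ∈ Ach ∧ x ∈ voronoiCell (windowAtomSet Ach ych yunc) (ych u)})
    fun e => voronoiCell (windowAtomSet Ach ych yunc) (yunc e)

/-- Reference positions indexed by `ι` (uncharted atoms are booked at the centre `q₀`, radius `0`). -/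
def siteI : Idx ⊕ μ → E3 := Sum.elim (placedSite s ν q R) fun _ => q₀

/-- Actual positions indexed by `ι`. -/
def atomIdx : Idx ⊕ μ → E3 := Sum.elim ych yunc

/-- Indices carrying an atom. -/
def chartedI : Set (Idx ⊕ μ) := Sum.inl '' Ach ∪ range Sum.inr

/-- Core indices: core sites and all uncharted atoms. -/
def collarCoreIdx : Set (Idx ⊕ μ) := Sum.inl '' collarCoreSites s ν q R q₀ r_c ∪ range Sum.inr

/-- The piece radius of a pair: `ν/2` for a bond (`barlowSiteForm = 12`), `0` for a √2-contact. -/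
def pieceRadius (k : Idx × Idx) : ℝ := if barlowSiteForm s k.1 k.2 = 12 then ν / 2 else 0

end Objects

/-! ## §2 Bookkeeping lemmas -/
section Lemmas

variable {μ : Type*} {s : ℤ → ℤ} {ν : ℝ} {q : E3} {R : E3 ≃ₗᵢ[ℝ] E3} {Ach : Set Idx} {ych : Idx → E3} {yunc : μ → E3}
  {q₀ : E3} {r_c : ℝ}

/-- support: a template index lies in the collar-core index set iff its placed site is within `r_c` of `q₀`. [this file] -/
theorem mem_collarCoreIdx_inl {u : Idx} :
    (Sum.inl u : Idx ⊕ μ) ∈ collarCoreIdx s ν q R q₀ r_c ↔ dist (placedSite s ν q R u) q₀ ≤ r_c := by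
  simp [collarCoreIdx, collarCoreSites, Sum.inl_injective.mem_set_image]

/-- support: every uncharted (core) index belongs to the collar-core index set. [this file] -/
theorem inr_mem_collarCoreIdx (e : μ) : (Sum.inr e : Idx ⊕ μ) ∈ collarCoreIdx s ν q R q₀ r_c :=
  mem_union_right _ (mem_range_self e)

/-- support: a template index is charted iff it lies in `Ach`. [this file] -/
theorem mem_chartedI_inl {u : Idx} : (Sum.inl u : Idx ⊕ μ) ∈ chartedI (μ := μ) Ach ↔ u ∈ Ach := by
  simp [chartedI, Sum.inl_injective.mem_set_image]

/-- support: every core index is charted. [this file] -/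
theorem inr_mem_chartedI (e : μ) : (Sum.inr e : Idx ⊕ μ) ∈ chartedI Ach := mem_union_right _ (mem_range_self e)

/-- support: the atom set is the image of the charted indices. [this file] -/
theorem windowAtomSet_eq_image : windowAtomSet Ach ych yunc = atomIdx ych yunc '' chartedI (μ := μ) Ach := by
  rw [chartedI, image_union, image_image, ← range_comp]
  rfl

/-- support: the reference core union over `ι` is `collarRefCore`. [this file] -/
theorem biUnion_collarCoreIdx_refCellI :
    ⋃ i ∈ collarCoreIdx (μ := μ) s ν q R q₀ r_c, refCellI (μ := μ) s ν q R i = collarRefCore s ν q R q₀ r_c := by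
  rw [collarCoreIdx, biUnion_union, biUnion_image, biUnion_range]
  simp only [refCellI, Sum.elim_inl, Sum.elim_inr, iUnion_empty, union_empty]
  rfl

/-- support: the actual core union over `ι` is `collarActCore`. [this file] -/
theorem biUnion_collarCoreIdx_actCellI :
    ⋃ i ∈ collarCoreIdx (μ := μ) s ν q R q₀ r_c, actCellI Ach ych yunc i = collarActCore s ν q R Ach ych yunc q₀ r_c := by
  rw [collarCoreIdx, biUnion_union, biUnion_image, biUnion_range, collarActCore]
  congr 1
  ext x
  simp only [actCellI, Sum.elim_inl, mem_iUnion, mem_setOf_eq, mem_inter_iff, exists_prop]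
  constructor
  · rintro ⟨u, hu, hA, hx⟩
    exact ⟨u, ⟨hu, hA⟩, hx⟩
  · rintro ⟨u, ⟨hu, hA⟩, hx⟩
    exact ⟨u, hu, hA, hx⟩

/-- support: a point of an actual cell is at least as close to its atom as to any atom. [this file] -/
theorem nearest_of_mem_actCellI {i : Idx ⊕ μ} {x : E3} (hx : x ∈ actCellI Ach ych yunc i) :
    ∀ j ∈ chartedI (μ := μ) Ach, dist x (atomIdx ych yunc i) ≤ dist x (atomIdx ych yunc j) := by
  intro j hj
  have hjY : atomIdx ych yunc j ∈ windowAtomSet Ach ych yunc := by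
    rw [windowAtomSet_eq_image]
    exact mem_image_of_mem _ hj
  cases i with
  | inl u => exact hx.2 _ hjY
  | inr e => exact hx _ hjY

/-- support: the indexed reference cells cover space (`0 < ν`, Hägg sequence). [«CollarSites»] -/
theorem iUnion_refCellI (hs : IsHaggSeq s) (hν : 0 < ν) : ⋃ i, refCellI (μ := μ) s ν q R i = univ := by
  rw [refCellI, iUnion_sumElim (refCell s ν q R) (fun _ : μ => (∅ : Set E3)), iUnion_empty, union_empty]
  exact iUnion_voronoiCell_placedSite hs hν

/-- support: circumradius of the indexed reference cells. [«CollarSites»] -/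
theorem refCellI_subset_closedBall (hs : IsHaggSeq s) (hν : 0 < ν) {r₀ : ℝ} (hr₀ : r₀ = ν / Real.sqrt 2) :
    ∀ i, refCellI (μ := μ) s ν q R i ⊆ closedBall (siteI s ν q R q₀ i) r₀ := by
  rintro (u | e)
  · rw [hr₀]; exact voronoiCell_placedSite_subset_closedBall hs hν u
  · exact empty_subset _

/-- support: indices outside the core are outer SITES, at distance `> r_c`. [this file] -/
theorem lt_dist_of_not_mem_collarCoreIdx {i : Idx ⊕ μ} (hi : i ∉ collarCoreIdx s ν q R q₀ r_c) : r_c < dist (siteI s ν q R q₀ i) q₀ := by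
  cases i with
  | inl u => exact lt_of_not_ge fun h => hi (mem_collarCoreIdx_inl.2 h)
  | inr e => exact absurd (inr_mem_collarCoreIdx e) hi

/-- support: members of the collar-core index set sit within `r_c` of `q₀` (`r_c ≥ 0`). [this file] -/
theorem dist_le_of_mem_collarCoreIdx (hrc : 0 ≤ r_c) {i : Idx ⊕ μ} (hi : i ∈ collarCoreIdx s ν q R q₀ r_c) :
    dist (siteI s ν q R q₀ i) q₀ ≤ r_c := by
  cases i with
  | inl u => exact mem_collarCoreIdx_inl.1 hi
  | inr e => simpa [siteI] using hrc

/-- support: the actual cells cover space when there is at least one charted atom and finitely many atoms.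
[«Collar» T0] -/
theorem iUnion_actCellI [Finite μ] (hA : Ach.Finite) (hne : Ach.Nonempty) :
    ⋃ i, actCellI Ach ych yunc i = univ := by
  refine eq_univ_of_forall fun x => ?_
  have hfin : (windowAtomSet Ach ych yunc).Finite := (hA.image _).union (finite_range _)
  obtain ⟨z, hz, hxz⟩ := exists_mem_voronoiCell (fun p r => hfin.inter_of_left _)
    ((hne.image ych).mono subset_union_left) x
  rcases hz with ⟨u, hu, rfl⟩ | ⟨e, rfl⟩
  · exact mem_iUnion.2 ⟨Sum.inl u, ⟨hu, hxz⟩⟩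
  · exact mem_iUnion.2 ⟨Sum.inr e, hxz⟩

/-- support: THE ANNULUS NO-HOLE CONDITION from the charted band (W-band): `2r₀ < r_c`, band `(r_c − m, r_c + M)` with
`2r₀ < m`, `r₀ < M`, every band site charted and displaced by `≤ û`. [«CollarBand» noHole_annulus_of_charted] -/
theorem noHole_annulus (hs : IsHaggSeq s) (hν : 0 < ν) {r₀ û m M : ℝ} (hr₀ : r₀ = ν / Real.sqrt 2) (h2r : 2 * r₀ < r_c)
    (hm : 2 * r₀ < m) (hM : r₀ < M)
    (hband : ∀ u, r_c - m < dist (placedSite s ν q R u) q₀ → dist (placedSite s ν q R u) q₀ < r_c + M →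
      u ∈ Ach ∧ dist (ych u) (placedSite s ν q R u) ≤ û) :
    ∀ x, r_c - r₀ ≤ dist x q₀ → dist x q₀ ≤ r_c →
      ∃ j ∈ chartedI (μ := μ) Ach, dist x (atomIdx ych yunc j) ≤ r₀ + û := by
  refine noHole_annulus_of_charted (K₁ := refCellI s ν q R) (qref := siteI s ν q R q₀) (a := r₀)
    (iUnion_refCellI hs hν) (refCellI_subset_closedBall hs hν hr₀) ?_
  rintro (u | e) h1 h2
  · obtain ⟨hA, hd⟩ := hband u (by simp only [siteI, Sum.elim_inl] at h1; linarith)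
      (by simp only [siteI, Sum.elim_inl] at h2; linarith)
    exact ⟨mem_chartedI_inl.2 hA, hd⟩
  · exfalso
    simp only [siteI, Sum.elim_inr, dist_self] at h1
    linarith

/-- support: the piece of a listed pair lies in the ball of radius `pieceRadius` about the midpoint (`ν/2` for bonds,
`0` for √2-contacts). [«CollarBand» lens radius + «CollarSites» integer form] -/
theorem refCell_inter_subset_closedBall (hs : IsHaggSeq s) (hν : 0 < ν) {k : Idx × Idx}
    (hk : barlowSiteForm s k.1 k.2 = 12 ∨ barlowSiteForm s k.1 k.2 = 24) :
    refCell s ν q R k.1 ∩ refCell s ν q R k.2 ⊆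
      closedBall (midpoint ℝ (placedSite s ν q R k.1) (placedSite s ν q R k.2)) (pieceRadius s ν k) := by
  have h1 := voronoiCell_placedSite_subset_closedBall (q := q) (R := R) hs hν k.1
  have h2 := voronoiCell_placedSite_subset_closedBall (q := q) (R := R) hs hν k.2
  refine ((inter_subset_inter h1 h2).trans (inter_closedBall_subset_closedBall_midpoint _ _ _)).trans
    (closedBall_subset_closedBall (le_of_eq ?_))
  have h12 := twelve_mul_dist_placedSite_sq (s := s) (q := q) (R := R) hν.le k.1 k.2
  have hr2 : (ν / Real.sqrt 2) ^ 2 = ν ^ 2 / 2 := by rw [div_pow, Real.sq_sqrt zero_le_two]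
  rw [hr2, pieceRadius]
  rcases hk with hk | hk
  · rw [if_pos hk]
    rw [hk] at h12
    have hd : dist (placedSite s ν q R k.1) (placedSite s ν q R k.2) ^ 2 = ν ^ 2 := by push_cast at h12; linarith
    rw [hd, show ν ^ 2 / 2 - ν ^ 2 / 4 = (ν / 2) ^ 2 by ring, Real.sqrt_sq (by positivity)]
  · rw [if_neg (by rw [hk]; norm_num)]
    rw [hk] at h12
    have hd : dist (placedSite s ν q R k.1) (placedSite s ν q R k.2) ^ 2 = 2 * ν ^ 2 := by push_cast at h12; linarith
    rw [hd, show ν ^ 2 / 2 - 2 * ν ^ 2 / 4 = 0 by ring, Real.sqrt_zero]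

/-- support: `collarRefCore` is measurable (a finite union of closed cells). [this file] -/
theorem measurableSet_collarRefCore (hs : IsHaggSeq s) (hν : 0 < ν) : MeasurableSet (collarRefCore s ν q R q₀ r_c) := by
  have hfin : (collarCoreSites s ν q R q₀ r_c).Finite := by
    have h := (finite_range_placedSite_inter_closedBall (q := q) (R := R) hs hν q₀ r_c).preimage
      ((placedSite_injective (q := q) (R := R) hs hν).injOn)
    refine h.subset fun u hu => ?_
    exact ⟨mem_range_self u, mem_closedBall.2 hu⟩
  exact hfin.measurableSet_biUnion fun u _ => (isClosed_voronoiCell _ _).measurableSet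

/-- support: `collarActCore` is measurable (`Ach` finite, `μ` countable). [this file] -/
theorem measurableSet_collarActCore [Countable μ] (hA : Ach.Finite) : MeasurableSet (collarActCore s ν q R Ach ych yunc q₀ r_c) := by
  refine MeasurableSet.union ?_ (MeasurableSet.iUnion fun e => (isClosed_voronoiCell _ _).measurableSet)
  exact (hA.inter_of_right _).measurableSet_biUnion fun u _ => (isClosed_voronoiCell _ _).measurableSet

end Lemmas

/-! ## §3 The interface row for the window -/
/-- ★★★ THE INTERFACE ROW FOR THE WINDOW (design (R*), WIRING-27Vc made a theorem about the route's objects).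
Reference: placed close-packed sites (`s` Hägg, `0 < ν`, rigid motion `(q, R)`), `r₀ = ν/√2`, bookkeeping core radius
`r_c > 2r₀` about `q₀`. Window facts (W-band)/(W-core)/(W-far) and atlas facts as in the file header. Then
`|∫_{collarActCore} g − ∫_{collarRefCore} g| ≤ Σ_{k∈I} c k · V k`. [this file] -/
theorem interfaceRow_window {μ : Type*} [Finite μ] {s : ℤ → ℤ} (hs : IsHaggSeq s) {ν : ℝ} (hν : 0 < ν) (q : E3)
    (R : E3 ≃ₗᵢ[ℝ] E3) {Ach : Set Idx} (hAfin : Ach.Finite) (hAne : Ach.Nonempty) (ych : Idx → E3) (yunc : μ → E3)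
    (q₀ : E3) {r_c r₀ û m M m' M' : ℝ} (hr₀ : r₀ = ν / Real.sqrt 2) (hrc : 2 * r₀ < r_c) (hm : 2 * r₀ < m) (hM : r₀ < M)
    (hm' : 2 * r₀ + û < m') (hM' : 3 * r₀ + û < M') (w : Idx → ℝ) (hw : ∀ u, 0 ≤ w u)
    -- (W-band): band sites are charted, displaced by ≤ û, and their actual cells are `w u`-near their reference cells
    (hband : ∀ u, r_c - m < dist (placedSite s ν q R u) q₀ → dist (placedSite s ν q R u) q₀ < r_c + M →
      u ∈ Ach ∧ dist (ych u) (placedSite s ν q R u) ≤ û)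
    (hnear : ∀ u, r_c - m < dist (placedSite s ν q R u) q₀ → dist (placedSite s ν q R u) q₀ < r_c + M →
      ∀ x ∈ voronoiCell (windowAtomSet Ach ych yunc) (ych u), ∃ x' ∈ refCell s ν q R u, dist x x' ≤ w u)
    -- (W-core): charted core atoms off the band, and all uncharted atoms, are deep in actual position
    (hcore : ∀ u ∈ Ach, dist (placedSite s ν q R u) q₀ ≤ r_c - m → dist (ych u) q₀ ≤ r_c - m')
    (hunc : ∀ e, dist (yunc e) q₀ ≤ r_c - m')
    -- (W-far): charted outer atoms off the band are far in actual position
    (hfar : ∀ u ∈ Ach, r_c + M ≤ dist (placedSite s ν q R u) q₀ → r_c + M' ≤ dist (ych u) q₀)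
    -- atlas: the piece list, widths, books, kernel bounds
    (I : Finset (Idx × Idx)) (W V c : Idx × Idx → ℝ) {g : E3 → ℝ}
    (hI : ∀ u ∈ collarCoreSites s ν q R q₀ r_c, ∀ u' ∉ collarCoreSites s ν q R q₀ r_c, barlowSiteForm s u u' ≤ 24 → (u, u') ∈ I)
    (hI' : ∀ k ∈ I, barlowSiteForm s k.1 k.2 = 12 ∨ barlowSiteForm s k.1 k.2 = 24) (hW0 : ∀ k ∈ I, 0 ≤ W k)
    (hWd : ∀ u, ∀ k ∈ I, dist (placedSite s ν q R u) (midpoint ℝ (placedSite s ν q R k.1) (placedSite s ν q R k.2)) ≤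
      r₀ + 2 * w u + pieceRadius s ν k → w u ≤ W k)
    (hgA : IntegrableOn g (collarRefCore s ν q R q₀ r_c)) (hgB : IntegrableOn g (collarActCore s ν q R Ach ych yunc q₀ r_c))
    (hgP : ∀ k ∈ I, IntegrableOn g (cthickening (W k) (refCell s ν q R k.1 ∩ refCell s ν q R k.2)))
    (hV : ∀ k ∈ I, (volume (cthickening (W k) (refCell s ν q R k.1 ∩ refCell s ν q R k.2))).toReal ≤ V k)
    (hc : ∀ k ∈ I, ∀ x ∈ cthickening (W k) (refCell s ν q R k.1 ∩ refCell s ν q R k.2), |g x| ≤ c k)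
    (hc0 : ∀ k ∈ I, 0 ≤ c k) :
    |(∫ x in collarActCore s ν q R Ach ych yunc q₀ r_c, g x) - ∫ x in collarRefCore s ν q R q₀ r_c, g x| ≤ ∑ k ∈ I, c k * V k := by
  haveI : Countable μ := inferInstance
  have hr₀pos : 0 < r₀ := by rw [hr₀]; positivity
  have hrc0 : 0 < r_c := by linarith
  -- the abstract data
  set K₁ : Idx ⊕ μ → Set E3 := refCellI s ν q R with hK₁def
  set K₂ : Idx ⊕ μ → Set E3 := actCellI Ach ych yunc with hK₂def
  set C : Set (Idx ⊕ μ) := collarCoreIdx s ν q R q₀ r_c with hCdef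
  set qI : Idx ⊕ μ → E3 := siteI s ν q R q₀ with hqIdef
  set yI : Idx ⊕ μ → E3 := atomIdx ych yunc with hyIdef
  set At : Set (Idx ⊕ μ) := chartedI Ach with hAtdef
  set wI : Idx ⊕ μ → ℝ := Sum.elim w fun _ => 0 with hwIdef
  set rI : Idx ⊕ μ → ℝ := Sum.elim (fun _ => r₀) fun _ => 0 with hrIdef
  set S : Idx × Idx → Set E3 := fun k => refCell s ν q R k.1 ∩ refCell s ν q R k.2 with hSdef
  -- generic facts about the instance
  have hcovRef : ⋃ j, K₁ j = univ := iUnion_refCellI hs hν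
  have hK₁ball : ∀ j, K₁ j ⊆ closedBall (qI j) r₀ := refCellI_subset_closedBall hs hν hr₀
  have hcov : ⋃ i, K₂ i = univ := iUnion_actCellI hAfin hAne
  have hK₂near : ∀ i, ∀ x ∈ K₂ i, ∀ j ∈ At, dist x (yI i) ≤ dist x (yI j) := fun i x hx => nearest_of_mem_actCellI hx
  have hout' : ∀ j ∉ C, r_c < dist (qI j) q₀ := fun j hj => lt_dist_of_not_mem_collarCoreIdx hj
  have hin : ∀ j ∈ C, dist (qI j) q₀ ≤ r_c := fun j hj => dist_le_of_mem_collarCoreIdx hrc0.le hj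
  have hhole : ∀ x, r_c - r₀ ≤ dist x q₀ → dist x q₀ ≤ r_c → ∃ j ∈ At, dist x (yI j) ≤ r₀ + û :=
    noHole_annulus hs hν hr₀ hrc hm hM hband
  have hUc₁ : (⋃ i ∈ C, K₁ i) = collarRefCore s ν q R q₀ r_c := biUnion_collarCoreIdx_refCellI
  have hUc₂ : (⋃ i ∈ C, K₂ i) = collarActCore s ν q R Ach ych yunc q₀ r_c := biUnion_collarCoreIdx_actCellI
  -- deep atoms: actual cell inside the reference core union
  have hdeep : ∀ i, dist (yI i) q₀ ≤ r_c - m' → K₂ i ⊆ ⋃ j ∈ C, K₁ j := fun i hi =>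
    deep_core_subset (û := û) (m := m') hrc0 le_rfl hcovRef hK₁ball hout' (hK₂near i) hhole (Or.inr ⟨hi, by linarith⟩)
  -- the six collar hypotheses
  have h : ∀ i ∈ C, ∀ x ∈ K₂ i, x ∉ ⋃ j ∈ C, K₁ j → ∃ x' ∈ K₁ i, dist x x' ≤ wI i := by
    rintro (u | e) hi x hx hxU
    · have hu : dist (placedSite s ν q R u) q₀ ≤ r_c := mem_collarCoreIdx_inl.1 hi
      rcases lt_or_ge (r_c - m) (dist (placedSite s ν q R u) q₀) with hb | hd
      · exact hnear u hb (by linarith) x hx.2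
      · exact absurd (hdeep (Sum.inl u) (hcore u hx.1 hd) hx) hxU
    · exact absurd (hdeep (Sum.inr e) (hunc e) hx) hxU
  have h' : ∀ i ∉ C, ∀ x ∈ K₂ i, x ∈ ⋃ j ∈ C, K₁ j → ∃ x' ∈ K₁ i, dist x x' ≤ wI i := by
    rintro (u | e) hi x hx hxU
    · have hu : r_c < dist (placedSite s ν q R u) q₀ := lt_of_not_ge fun h => hi (mem_collarCoreIdx_inl.2 h)
      rcases lt_or_ge (dist (placedSite s ν q R u) q₀) (r_c + M) with hb | hf
      · exact hnear u (by linarith) hb x hx.2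
      · exfalso
        have hdis := far_outer_disjoint_of_pos (i := Sum.inl u) hrc0 le_rfl hK₁ball hin (hK₂near _) hhole
          (hfar u hx.1 hf) (by linarith)
        have : x ∈ K₂ (Sum.inl u) ∩ ⋃ j ∈ C, K₁ j := ⟨hx, hxU⟩
        rw [hdis] at this
        exact this
    · exact absurd (inr_mem_collarCoreIdx e) hi
  have hout : ∀ i ∉ C, (K₂ i ∩ ⋃ j ∈ C, K₁ j).Nonempty → K₁ i ⊆ closure (⋃ j ∈ C, K₁ j)ᶜ := by
    rintro (u | e) hi -
    · have hu : u ∉ collarCoreSites s ν q R q₀ r_c := fun h => hi (mem_collarCoreIdx_inl.2 h)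
      have e : (⋃ u' ∈ collarCoreSites s ν q R q₀ r_c, refCell s ν q R u') =
          ⋃ z ∈ placedSite s ν q R '' collarCoreSites s ν q R q₀ r_c, voronoiCell (range (placedSite s ν q R)) z := by
        rw [biUnion_image]
        rfl
      rw [hUc₁, collarRefCore, e]
      show refCell s ν q R u ⊆ _
      refine voronoiCell_subset_closure_compl (finite_range_placedSite_inter_closedBall hs hν) (image_subset_range _ _)
        (mem_range_self u) ?_
      rintro ⟨u', hu', he⟩
      exact hu ((placedSite_injective hs hν he) ▸ hu')
    · exact absurd (inr_mem_collarCoreIdx e) hi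
  have hS : frontier (⋃ j ∈ C, K₁ j) ⊆ ⋃ k ∈ (I : Set (Idx × Idx)), S k := by
    rw [hUc₁]
    refine frontier_subset_biUnion_pairs (placedSite s ν q R) I (finite_range_placedSite_inter_closedBall hs hν)
      (dist_le_of_mem_voronoiCell_placedSite hs hν) fun u hu u' hu' hd => hI u hu u' hu' ?_
    exact siteForm_le_of_dist_le hν hd
  have hwI : ∀ i, 0 ≤ wI i := by rintro (u | e); exacts [hw u, le_rfl]
  have hK : ∀ i, K₁ i ⊆ closedBall (qI i) (rI i) := by
    rintro (u | e)
    · exact hK₁ball (Sum.inl u)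
    · exact empty_subset _
  have hSm : ∀ k ∈ (I : Set (Idx × Idx)),
      S k ⊆ closedBall (midpoint ℝ (placedSite s ν q R k.1) (placedSite s ν q R k.2)) (pieceRadius s ν k) :=
    fun k hk => refCell_inter_subset_closedBall hs hν (hI' k hk)
  have hWd' : ∀ i, ∀ k ∈ (I : Set (Idx × Idx)),
      dist (qI i) (midpoint ℝ (placedSite s ν q R k.1) (placedSite s ν q R k.2)) ≤ rI i + 2 * wI i + pieceRadius s ν k →
        wI i ≤ W k := by
    rintro (u | e) k hk hd
    · exact hWd u k hk hd
    · exact hW0 k hk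
  have hmain := interfaceRow_le_of_dist (C := C) (K₁ := K₁) (K₂ := K₂) (w := wI) (g := g) I S W V c hS hcov h h' hout
    hwI hK hSm hWd' (hUc₁ ▸ measurableSet_collarRefCore hs hν) (hUc₂ ▸ measurableSet_collarActCore hAfin)
    (hUc₁ ▸ hgA) (hUc₂ ▸ hgB) hgP hV hc hc0
  rw [hUc₁, hUc₂] at hmain
  exact hmain

end

end Summit.AtomisticToContinuum.Crystallization.Theorems.OverbindingBudgetAffineFarFieldCollarWindow
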